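import Summits.BirchSwinnertonDyer.Rank1Residual.Partition.MainConjecturesEisensteinTwistIdentity
import Summits.BirchSwinnertonDyer.Rank1Residual.X1.RankZeroPartner
import Literature.NumberTheory.EllipticCurves.Rank1Residual.EisensteinGoodComplementSplit
import HarnessLib

/-!
# Row C6 ∩ {r = 1} (the literal flag `CGS25-BST-Thm311`, scoreboard row D4): `BSD(E,p)` for the
# rank-one curve is EQUIVALENT to `BSD(E^K,p)` for its rank-zero twist, from REFEREED,
# Beilinson–Flach-free print — and hence follows from ONE per-class certificate on the twist

HONEST FRAMING (cell `bsd-litref`, run/shared/lean/pub/bsd-litref/; programme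
`BSD-LIT2PART-PROGRAMME-v1.md` §T2d, verbatim): "no tranche here proves BSD; ARM L moves the LITERAL
column of an r ≤ 1 census into the kernel-proved-modulo-named-print column". This file is a
`Proofs`-style Summits file: THEOREMS ONLY — no definition, no new named fact, nothing asserted. Seat
`bsd-litref-cgs25-pv` (prover: "re-route consumers to the refereed statement; per-class re-derivation
where hypotheses narrow").

## What and why

The 2 049 classes of scoreboard row D4 are the covered-row-C6 pairs `(E, p)` — `p > 2` good,
`E[p]` reducible, `a_p ≢ 1 (mod p)` — whose ONLY closing theorem of record is Castella–Grossi–Skinner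
2025 Thm. D (`CastellaGrossiSkinner2025.thmD_padicValRat_bsd_rank_le_one`, Math. Ann. 393 (2025),
REFEREED), carried LITERAL under the informational flag `CGS25-BST-Thm311` (referee A R156.2 /
R171.2): Thm. D ⇐ Thm. A (Mazur's main conjecture) ⇐ printed Thm. 4.1.1 (arXiv v1: 3.1.1; the
two-variable Beilinson–Flach class `BF_α`, its Coleman maps and two explicit reciprocity laws), whose
entire printed proof is "This is proved in [BST, §5] …", [BST] = [BSTW23] = Burungale–Skinner–Tian–Wan,
*Zeta elements for elliptic curves and applications*, arXiv:2409.01350 (§4 of the arXiv text: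
Thms. 4.5 / 4.7 / 4.10 / 4.11 and Thm. 1.21) — a PREPRINT (unrefereed 2026-08-26). After the fold
F-β′ (R171.2) the classes still literal are exactly those NOT recovered by the two refereed,
Beilinson–Flach-free re-routes already in the kernel: `r = 0` with `p ∣ #Ш_an(E)` (Wuthrich 2014
Prop. 21 does not fire) and `r = 1` with Greenberg–Vatsal parity `gvpar(p)` (Castella–Grossi–Lee–
Skinner 2022 Thm. F = `RowC6.bsdp_rankOne_of_display55_of_gvThm13` needs the opposite parity).

For the `r = 1` half this file RE-ROUTES the pair to refereed print PLUS ONE FINITE CERTIFICATE, with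
NO parity hypothesis and NO Castella–Grossi–Skinner 2025 input. The printed proof of CGS Thm. D at
`r = 1` is "we argue as in [CGLS22], choosing a suitable `K` with `L(E^K,1) ≠ 0` and applying our
result in the rank `0` case to `E^K`" (`[corpus: paper:arxiv-2303.04373 p0005 L59–L61]`); "as in
[CGLS22]" = the proof of CGLS22 Thm. 5.3.1 up to its display (5.7), which rests on the
ANTICYCLOTOMIC package only (display (5.5): CGLS22 Thm. 4.2.2 + Thm. 5.1.1 + Thm. 5.1.3, Invent.
Math. 227 (2022), REFEREED, no Beilinson–Flach class; tree fact
`CastellaGrossiLeeSkinner2022.display55_sha_heegnerIndex`, registry A157) and is already carried out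
IN THE KERNEL at one datum by `TwistIdentity.display57_at_of_display55` (Manin constant cancelling,
every odd `p`). The Beilinson–Flach input enters ONLY through "our result in the rank `0` case" for
the twist `E^K`. Hence, at one admissible `K` and one globally minimal model `Wd` of `E^{(d_K)}`:

* `RowC6.bsdp_rankOne_of_display55_at_twist_pPartRankZero` — (5.5) + the rank-zero print shape
  `PPartRankZero Wd p` of THIS ONE twist ⟹ `BSDp W p` (datum-free pointwise form of session-3's
  `RowC6.bsdp_rankOne_at_of_display55_of_partner_of_odd`, which asks for an explicit Heegner datum with
  `p ∤ c(Dt)`; here the datum is PRODUCED — `nonempty_modularParametrizationData`,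
  `nonempty_heegnerDatum_holds`, `heegnerPointComplex_mem_range_map_holds` — and its Manin constant
  cancels, exactly as in `display57_of_display55`).
* `RowC6.bsdp_twist_of_display55_of_bsdp_rankOne` and
  `RowC6.bsdp_rankOne_iff_bsdp_twist_of_display55` — the RE-ROUTE AS AN EQUIVALENCE: granted (5.5),
  Gross–Zagier, Kolyvagin, GZK and modularity, `BSDp W p ↔ BSDp Wd p`. So on row D4 ∩ {r = 1} the
  `p`-part of BSD for the rank-one curve IS the `p`-part of BSD for a rank-zero good Eisenstein
  non-anomalous curve (`partner_good_red_not_anom`) — every refereed rank-zero theorem or certificate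
  for `E^K` transfers verbatim, and conversely nothing is lost.
* `RowC6.bsdp_rankOne_of_display55_of_twistShaAnUnit` — the PER-CLASS RE-DERIVATION: if
  `#Ш_an(E^{(d_K)})` is a rational `p`-adic unit (a finite, exact computation on a rank-zero curve:
  the census lane's T-WU14 currency), then `BSDp W p`, through Wuthrich 2014 Prop. 21
  (`Wuthrich2014.sha_dvd_analyticSha`, Doc. Math., REFEREED; Kato's Euler system, no Beilinson–Flach
  class) on the twist (`Rank1Residual.bsdp_of_good_red_rankZero_of_shaAn_unit`). Inputs by name:
  A157 (5.5), Wuthrich Prop. 21, Gross–Zagier (both currencies), Kolyvagin, GZK, modularity — all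
  PUBLISHED and REFEREED; the hypotheses that NARROW are per class and decidable: an admissible `K`
  ((a) `d_K` odd `< −4`, (b) Heegner for `N_E`, (c) `p` split, (d) `L(E^{(d_K)},1) ≠ 0`) with
  `ord_p #Ш_an(E^{(d_K)}) = 0`.
* `RowC6.bsdp_rankOne_of_display55_of_twistGVPar` — the same with the twist's rank-zero shape from
  Greenberg–Vatsal 2000 Thm. 1.3 + Greenberg Thm. 4.1 when the TWIST has (GV) parity (no certificate;
  this is CGLS22 Thm. F's locus read on `E^K`, recorded so that the three rank-zero sources for the
  twist — GV, Wuthrich certificate, CGS Thm. A — sit side by side).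

Nothing here changes a label: the flag and the bookings are the referees'. What the file gives the
census lane is a NAMED kernel theorem per certificate kind, so that a D4 rank-one class with a
certified twist books by name exactly as the T-WU14 / T-CGLS-F recoveries did (R171.2).

References: [CastellaGrossiLeeSkinner2022] Invent. Math. 227 (2022), proof of Thm. 5.3.1,
(5.5)–(5.7); [CastellaGrossiSkinner2025] Math. Ann. 393 (2025), Thm. D and its proof (§1.2),
Thm. 4.1.1 (the [BSTW23, §5] sentence); [Wuthrich2014] J. Algebra / Doc. Math. Prop. 21;
[GreenbergVatsal2000] Thm. (1.3); [GreenbergLNM1716] Thm. 4.1; [GrossZagier1986] I.(6.5), V.§2,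
Thm. I.7.3; [Gross1991] Thm. 1.3; [Miller2011LMS] Def. 1.1. Records: pub-bsdpct/REFEREE.md R156.2,
R171.2; pub-bsdres/PARTITION-SCOREBOARD.md row D4; b2b-bsdres-x1a/X1-RESEARCH-BRIEF.md §3 (the
public text of Thm. 3.1.1 is BSTW §4).
-/

set_option autoImplicit false

noncomputable section

open scoped Classical

open WeierstrassCurve NumberField Literature.NumberTheory.EllipticCurves
  Literature.NumberTheory.EllipticCurves.ModularForms Literature.NumberTheory.QuadraticFields
  Literature.NumberTheory.EllipticCurves.Rank1Residual
  Literature.NumberTheory.EllipticCurves.CastellaGrossiLeeSkinner2022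
  Literature.NumberTheory.EllipticCurves.Wuthrich2014

namespace Summit.BirchSwinnertonDyer.Rank1Residual

/-! ### §1 (5.5) at a PRODUCED Heegner datum ⇒ the display (5.7) at `(E, p, K, Wd)` in Keller–Yin's shape -/

/-- **(5.7) at one admissible `(E, p, K, Wd)`, datum-free, torsion terms included (they vanish).**
For `W/ℚ` globally minimal elliptic, `p > 2` good with `E[p]` reducible and `a_p ≢ 1 (mod p)`,
`ord_{s=1}L(E,s) = 1`, `K` admissible ((a)–(d)) and `Wd` a globally minimal model of `E^{(d_K)}`:
granted (5.5) (`h55`), Gross–Zagier (`hGZ`), Kolyvagin (`hKo`), GZK and modularity (`hmodP` produces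
the parametrisation datum, `hmod` the Artin formalism), the Keller–Yin-shaped identity between the
valuations of the normalised leading terms of `W` and `Wd` holds for every pair of rational values —
`TwistIdentity.display57_at_of_display55` at the datum produced as in `display57_of_display55`, with
`ord_p #E(ℚ)_tors = ord_p #E^K(ℚ)_tors = 0` (`not_dvd_torsionOrder_of_not_anom`,
`partner_good_red_not_anom`). [cite: CastellaGrossiLeeSkinner2022, proof of Thm. 5.3.1, displays (5.5)–(5.7)]
[cite: GrossZagier1986, I.(6.5), V.§2] [cite: Gross1991, Thm. 1.3] -/
theorem RowC6.display_at_of_display55 (h55 : display55_sha_heegnerIndex)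
    (hmodP : nonempty_modularParametrizationData) (hmod : hasEntireLFunction_rat)
    (hGZ : ∀ (N : ℕ) [NeZero N] (W : WeierstrassCurve ℚ) (K : Type) [Field K] [NumberField K],
      gross_zagier N W K)
    (hKo : ∀ (N : ℕ) [NeZero N] (W : WeierstrassCurve ℚ) (K : Type) [Field K] [NumberField K],
      kolyvagin N W K)
    (hGZK : rank_eq_analyticRank_of_analyticRank_le_one)
    (W : WeierstrassCurve ℚ) [W.IsElliptic] [W.IsGloballyMinimal] (p : ℕ) [Fact p.Prime]
    (hp : 2 < p) (hgood : Good W p) (hred : Red W p) (hna : ¬ Anom W p) (hr : W.analyticRank = 1)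
    (K : Type) [Field K] [NumberField K] (hK : IsImaginaryQuadratic K)
    (hodd : Odd (NumberField.discr K)) (hlt : NumberField.discr K < -4)
    (hHN : SatisfiesHeegnerHypothesis (W.conductorNorm ℤ) K) (hHp : SatisfiesHeegnerHypothesis p K)
    (hLt : (W.quadraticTwist (NumberField.discr K : ℚ)).entireLFunction 1 ≠ 0)
    (Wd : WeierstrassCurve ℚ) [Wd.IsElliptic] [Wd.IsGloballyMinimal]
    (hWd : ∃ C : VariableChange ℚ, C • Wd = W.quadraticTwist (NumberField.discr K : ℚ)) :
    ∀ (q qd : ℚ), W.leadingLCoeff / ((W.realPeriodRat * W.regulator : ℝ) : ℂ) = (q : ℂ) →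
        Wd.entireLFunction 1 / (Wd.realPeriodRat : ℂ) = (qd : ℂ) →
        padicValRat p q - ((padicValNat p W.shaOrder : ℤ) + padicValNat p W.tamagawaProduct -
            2 * padicValNat p W.torsionOrder) =
          -(padicValRat p qd - ((padicValNat p Wd.shaOrder : ℤ) + padicValNat p Wd.tamagawaProduct -
            2 * padicValNat p Wd.torsionOrder)) := by
  intro q qd hq hqd
  haveI : NeZero (W.conductorNorm ℤ) := ⟨(W.conductorNorm_pos_holds).ne'⟩
  -- the Heegner datum, PRODUCED (any Manin constant: it cancels in (5.5) + (5.6) ⇒ (5.7))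
  obtain ⟨Dt⟩ := hmodP W
  obtain ⟨β, hβ⟩ := exists_dvd_sq_sub_discr_holds (W.conductorNorm ℤ) K hK hHN
  obtain ⟨H, -⟩ := nonempty_heegnerDatum_holds (W.conductorNorm ℤ) K hK hβ
  obtain ⟨ι⟩ : Nonempty (K →+* ℂ) := inferInstance
  obtain ⟨P, hP⟩ := heegnerPointComplex_mem_range_map_holds (W.conductorNorm ℤ) W K hK hHN Dt H ι
  -- (5.7) at the datum
  have h57 := TwistIdentity.display57_at_of_display55 h55 W p (W.conductorNorm ℤ) K Dt H ι P
    (hGZ _ W K) (hKo _ W K) hGZK hmod hp hgood hred hna hr rfl hK hodd hlt hHN hHp hLt hP Wd hWd q qd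
    hq hqd
  -- no `p`-torsion on either side at a non-anomalous good Eisenstein `p > 2`
  obtain ⟨hgood_d, -, hna_d⟩ := partner_good_red_not_anom hp hgood hred hna K hK hodd hHp Wd hWd
  have ht : padicValNat p W.torsionOrder = 0 :=
    padicValNat.eq_zero_of_not_dvd (not_dvd_torsionOrder_of_not_anom W p hp hgood hna)
  have htd : padicValNat p Wd.torsionOrder = 0 :=
    padicValNat.eq_zero_of_not_dvd (not_dvd_torsionOrder_of_not_anom Wd p hp hgood_d hna_d)
  rw [ht, htd]
  simp only [Nat.cast_zero, mul_zero, sub_zero]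
  linarith

/-- **The twist has analytic rank `0`.** For `Wd` any elliptic model of `E^{(d_K)}` with
`L(E^{(d_K)},1) ≠ 0`: `Wd.analyticRank = 0` (the `L`-function is an isomorphism invariant,
`analyticRank_smul`; `ord_{s=1} = 0 ⟺ L(1) ≠ 0` under modularity, `analyticRank_eq_zero_iff_holds`).
Bookkeeping. [folklore] -/
theorem RowC6.analyticRank_twist_eq_zero (hmod : hasEntireLFunction_rat)
    (W : WeierstrassCurve ℚ) [W.IsElliptic] (K : Type) [Field K] [NumberField K]
    (hLt : (W.quadraticTwist (NumberField.discr K : ℚ)).entireLFunction 1 ≠ 0)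
    (Wd : WeierstrassCurve ℚ) [Wd.IsElliptic]
    (hWd : ∃ C : VariableChange ℚ, C • Wd = W.quadraticTwist (NumberField.discr K : ℚ)) :
    Wd.analyticRank = 0 := by
  have hD0 : (NumberField.discr K : ℚ) ≠ 0 := by exact_mod_cast NumberField.discr_ne_zero K
  haveI hEt : (W.quadraticTwist (NumberField.discr K : ℚ)).IsElliptic :=
    W.isElliptic_quadraticTwist hD0
  obtain ⟨C, hC⟩ := hWd
  have hrt : (W.quadraticTwist (NumberField.discr K : ℚ)).analyticRank = 0 :=
    ((W.quadraticTwist _).analyticRank_eq_zero_iff_holds (hmod _)).2 hLt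
  rw [← analyticRank_smul Wd C, hC, hrt]

/-! ### §2 The re-route: `BSD(E,p)` for the rank-one curve ⟺ `BSD(E^K,p)` for the rank-zero twist -/

/-- **Row C6 ∩ {r = 1}: (5.5) + the rank-zero print shape of ONE twist ⟹ `BSD(E,p)`.** For `W/ℚ`
globally minimal elliptic, `p > 2` good with `E[p]` reducible and `a_p ≢ 1 (mod p)`,
`ord_{s=1}L(E,s) = 1`, ONE admissible `K` ((a) `d_K` odd `< −4`, (b) every `ℓ ∣ N_E` split, (c) `p`
split, (d) `L(E^{(d_K)},1) ≠ 0`) and ONE globally minimal model `Wd` of `E^{(d_K)}` with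
`PPartRankZero Wd p`: `BSDp W p`. Inputs by name: (5.5) (`h55`, CGLS22, REFEREED, anticyclotomic —
no Beilinson–Flach class), Gross–Zagier over `K` (`hGZ`) and over `ℚ` (`hGZQ`, Thm. I.7.3: the
rationality of `L'(E,1)/(Ω·Reg)`), Kolyvagin (`hKo`), GZK (`hGZK`), modularity (`hmodP`, `hnf`). NO
parity hypothesis, NO Castella–Grossi–Skinner 2025 input: the printed `r = 1` argument of CGS Thm. D /
CGLS Thm. 5.3.1 with "the result in the rank `0` case for `E^K`" left as the hypothesis `htw`.
[cite: CastellaGrossiSkinner2025, Thm. D and its proof (§1.2; arXiv v1 §0.3 p. 5)]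
[cite: CastellaGrossiLeeSkinner2022, proof of Thm. 5.3.1, (5.5)–(5.7)] [cite: GrossZagier1986, Thm. I.7.3]
[cite: Miller2011LMS, Def. 1.1] -/
theorem RowC6.bsdp_rankOne_of_display55_at_twist_pPartRankZero (h55 : display55_sha_heegnerIndex)
    (hmodP : nonempty_modularParametrizationData) (hnf : exists_isNewformOf)
    (hGZQ : GrossZagier1986_thm_I_7_3)
    (hGZ : ∀ (N : ℕ) [NeZero N] (W : WeierstrassCurve ℚ) (K : Type) [Field K] [NumberField K],
      gross_zagier N W K)
    (hKo : ∀ (N : ℕ) [NeZero N] (W : WeierstrassCurve ℚ) (K : Type) [Field K] [NumberField K],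
      kolyvagin N W K)
    (hGZK : rank_eq_analyticRank_of_analyticRank_le_one)
    (W : WeierstrassCurve ℚ) [W.IsElliptic] [W.IsGloballyMinimal] (p : ℕ) [Fact p.Prime]
    (hp : 2 < p) (hgood : Good W p) (hred : Red W p) (hna : ¬ Anom W p) (hr : W.analyticRank = 1)
    (K : Type) [Field K] [NumberField K] (hK : IsImaginaryQuadratic K)
    (hodd : Odd (NumberField.discr K)) (hlt : NumberField.discr K < -4)
    (hHN : SatisfiesHeegnerHypothesis (W.conductorNorm ℤ) K) (hHp : SatisfiesHeegnerHypothesis p K)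
    (hLt : (W.quadraticTwist (NumberField.discr K : ℚ)).entireLFunction 1 ≠ 0)
    (Wd : WeierstrassCurve ℚ) [Wd.IsElliptic] [Wd.IsGloballyMinimal]
    (hWd : ∃ C : VariableChange ℚ, C • Wd = W.quadraticTwist (NumberField.discr K : ℚ))
    (htw : PPartRankZero Wd p) : BSDp W p :=
  bsdp_of_display_at_of_pPartRankZero hnf hGZQ hGZK W p hr Wd htw
    (RowC6.display_at_of_display55 h55 hmodP (hasEntireLFunction_rat_of_exists_isNewformOf hnf) hGZ hKo
      hGZK W p hp hgood hred hna hr K hK hodd hlt hHN hHp hLt Wd hWd)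

/-- **The twist is a rank-zero good Eisenstein NON-anomalous curve, and `BSD(E^K,p)` gives its
rank-zero print shape.** For `Wd` a globally minimal model of `E^{(d_K)}` as above with
`L(E^{(d_K)},1) ≠ 0`: `Wd.analyticRank = 0`, and `BSDp Wd p → PPartRankZero Wd p` (bookkeeping:
`pPart_of_bsdp`, `pPartRankZero_of_pPart`). [cite: Miller2011LMS, Def. 1.1] [cite: Darmon2004, Thm. 3.22] -/
theorem RowC6.pPartRankZero_twist_of_bsdp (hmod : hasEntireLFunction_rat)
    (hGZK : rank_eq_analyticRank_of_analyticRank_le_one)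
    (W : WeierstrassCurve ℚ) [W.IsElliptic] (p : ℕ) [Fact p.Prime]
    (K : Type) [Field K] [NumberField K]
    (hLt : (W.quadraticTwist (NumberField.discr K : ℚ)).entireLFunction 1 ≠ 0)
    (Wd : WeierstrassCurve ℚ) [Wd.IsElliptic] [Wd.IsGloballyMinimal]
    (hWd : ∃ C : VariableChange ℚ, C • Wd = W.quadraticTwist (NumberField.discr K : ℚ))
    (hB : BSDp Wd p) : Wd.analyticRank = 0 ∧ PPartRankZero Wd p := by
  have hrd : Wd.analyticRank = 0 := RowC6.analyticRank_twist_eq_zero hmod W K hLt Wd hWd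
  exact ⟨hrd, pPartRankZero_of_pPart hGZK Wd p hrd (pPart_of_bsdp hmod hGZK Wd p (by omega) hB)⟩

/-- **Converse: `BSD(E,p)` for the rank-one curve ⟹ `BSD(E^K,p)` for the twist** (granted (5.5) and
the published Heegner-point facts). Both defects vanish together: the display of
`RowC6.display_at_of_display55` reads `defect_p(E) = −defect_p(E^K)`; `BSDp W p` kills the left side
(`pPart_of_bsdp`), `L(E^K,1)/Ω_{E^K}` is rational (modular symbols,
`X1.RankZeroPartner.exists_rat_entireLFunction_one_div_realPeriodRat`), so the right side is the
rank-zero print shape of `Wd`, whence `BSDp Wd p` (`bsdp_of_pPartRankZero`).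
[cite: CastellaGrossiLeeSkinner2022, proof of Thm. 5.3.1, (5.5)–(5.7)] [cite: Miller2011LMS, Def. 1.1] -/
theorem RowC6.bsdp_twist_of_display55_of_bsdp_rankOne (h55 : display55_sha_heegnerIndex)
    (hmodP : nonempty_modularParametrizationData) (hnf : exists_isNewformOf)
    (hGZ : ∀ (N : ℕ) [NeZero N] (W : WeierstrassCurve ℚ) (K : Type) [Field K] [NumberField K],
      gross_zagier N W K)
    (hKo : ∀ (N : ℕ) [NeZero N] (W : WeierstrassCurve ℚ) (K : Type) [Field K] [NumberField K],
      kolyvagin N W K)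
    (hGZK : rank_eq_analyticRank_of_analyticRank_le_one)
    (W : WeierstrassCurve ℚ) [W.IsElliptic] [W.IsGloballyMinimal] (p : ℕ) [Fact p.Prime]
    (hp : 2 < p) (hgood : Good W p) (hred : Red W p) (hna : ¬ Anom W p) (hr : W.analyticRank = 1)
    (K : Type) [Field K] [NumberField K] (hK : IsImaginaryQuadratic K)
    (hodd : Odd (NumberField.discr K)) (hlt : NumberField.discr K < -4)
    (hHN : SatisfiesHeegnerHypothesis (W.conductorNorm ℤ) K) (hHp : SatisfiesHeegnerHypothesis p K)
    (hLt : (W.quadraticTwist (NumberField.discr K : ℚ)).entireLFunction 1 ≠ 0)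
    (Wd : WeierstrassCurve ℚ) [Wd.IsElliptic] [Wd.IsGloballyMinimal]
    (hWd : ∃ C : VariableChange ℚ, C • Wd = W.quadraticTwist (NumberField.discr K : ℚ))
    (hB : BSDp W p) : BSDp Wd p := by
  have hmod : hasEntireLFunction_rat := hasEntireLFunction_rat_of_exists_isNewformOf hnf
  -- the rank-one side: `BSD(E,p)` is the print shape `PPart W p`
  obtain ⟨q, hq, hv⟩ := pPart_of_bsdp hmod hGZK W p (by omega) hB
  -- the rank-zero side: `L(E^K,1)/Ω_{E^K}` is a rational `qd`
  obtain ⟨qd, hqd⟩ := X1.RankZeroPartner.exists_rat_entireLFunction_one_div_realPeriodRat hmodP Wd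
  -- the display at `(q, qd)` transfers the vanishing of the defect
  have hdisp := RowC6.display_at_of_display55 h55 hmodP hmod hGZ hKo hGZK W p hp hgood hred hna hr K
    hK hodd hlt hHN hHp hLt Wd hWd q qd hq hqd
  have hvd : padicValRat p qd = (padicValNat p Wd.shaOrder : ℤ) + padicValNat p Wd.tamagawaProduct -
      2 * padicValNat p Wd.torsionOrder := by
    rw [hv] at hdisp
    linarith
  exact bsdp_of_pPartRankZero Wd p hmod hGZK (RowC6.analyticRank_twist_eq_zero hmod W K hLt Wd hWd)
    ⟨qd, hqd, hvd⟩

/-- **THE RE-ROUTE AS AN EQUIVALENCE (row D4 ∩ {r = 1}).** For `W/ℚ` globally minimal elliptic,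
`p > 2` good with `E[p]` reducible and `a_p ≢ 1 (mod p)`, `ord_{s=1}L(E,s) = 1`, an admissible `K`
((a)–(d)) and a globally minimal model `Wd` of the twist `E^{(d_K)}` (a rank-ZERO good Eisenstein
non-anomalous curve at `p`, `partner_good_red_not_anom`): granted CGLS22 display (5.5), Gross–Zagier,
Kolyvagin, GZK and modularity — all PUBLISHED, REFEREED and Beilinson–Flach-free —
`BSDp W p ↔ BSDp Wd p`. The literal flag `CGS25-BST-Thm311` on a rank-one class is therefore EXACTLY
the question of `BSD(E^K,p)` for any one admissible twist: every refereed rank-zero source for `E^K`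
(Greenberg–Vatsal under (GV) for the twist; Wuthrich 2014 Prop. 21 with `p ∤ #Ш_an(E^K)`; a descent
certificate) closes the rank-one pair, and only Castella–Grossi–Skinner's Thm. A closes it class-wide.
[cite: CastellaGrossiSkinner2025, Thm. D and its proof (§1.2)] [cite: CastellaGrossiLeeSkinner2022, proof of Thm. 5.3.1, (5.5)–(5.7)]
[cite: Miller2011LMS, Def. 1.1] -/
theorem RowC6.bsdp_rankOne_iff_bsdp_twist_of_display55 (h55 : display55_sha_heegnerIndex)
    (hmodP : nonempty_modularParametrizationData) (hnf : exists_isNewformOf)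
    (hGZQ : GrossZagier1986_thm_I_7_3)
    (hGZ : ∀ (N : ℕ) [NeZero N] (W : WeierstrassCurve ℚ) (K : Type) [Field K] [NumberField K],
      gross_zagier N W K)
    (hKo : ∀ (N : ℕ) [NeZero N] (W : WeierstrassCurve ℚ) (K : Type) [Field K] [NumberField K],
      kolyvagin N W K)
    (hGZK : rank_eq_analyticRank_of_analyticRank_le_one)
    (W : WeierstrassCurve ℚ) [W.IsElliptic] [W.IsGloballyMinimal] (p : ℕ) [Fact p.Prime]
    (hp : 2 < p) (hgood : Good W p) (hred : Red W p) (hna : ¬ Anom W p) (hr : W.analyticRank = 1)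
    (K : Type) [Field K] [NumberField K] (hK : IsImaginaryQuadratic K)
    (hodd : Odd (NumberField.discr K)) (hlt : NumberField.discr K < -4)
    (hHN : SatisfiesHeegnerHypothesis (W.conductorNorm ℤ) K) (hHp : SatisfiesHeegnerHypothesis p K)
    (hLt : (W.quadraticTwist (NumberField.discr K : ℚ)).entireLFunction 1 ≠ 0)
    (Wd : WeierstrassCurve ℚ) [Wd.IsElliptic] [Wd.IsGloballyMinimal]
    (hWd : ∃ C : VariableChange ℚ, C • Wd = W.quadraticTwist (NumberField.discr K : ℚ)) :
    BSDp W p ↔ BSDp Wd p := by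
  refine ⟨fun hB ↦ RowC6.bsdp_twist_of_display55_of_bsdp_rankOne h55 hmodP hnf hGZ hKo hGZK W p hp
      hgood hred hna hr K hK hodd hlt hHN hHp hLt Wd hWd hB, fun hBd ↦ ?_⟩
  exact RowC6.bsdp_rankOne_of_display55_at_twist_pPartRankZero h55 hmodP hnf hGZQ hGZ hKo hGZK W p hp
    hgood hred hna hr K hK hodd hlt hHN hHp hLt Wd hWd
    (RowC6.pPartRankZero_twist_of_bsdp (hasEntireLFunction_rat_of_exists_isNewformOf hnf) hGZK W p K
      hLt Wd hWd hBd).2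

/-! ### §3 Per class: the refereed rank-zero sources for the twist -/

/-- **Row D4 ∩ {r = 1}, PER CLASS, from refereed Beilinson–Flach-free print and ONE certificate:
`p ∤ #Ш_an(E^K)`.** For `W/ℚ` globally minimal elliptic, `p > 2` good with `E[p]` reducible and
`a_p ≢ 1 (mod p)`, `ord_{s=1}L(E,s) = 1`, an admissible `K` ((a)–(d)) and a globally minimal model
`Wd` of `E^{(d_K)}` whose analytic order of `Ш` is a rational of `p`-adic valuation `0` (`hunit` — a
finite exact computation on a rank-zero curve): `BSDp W p`. The twist is good, Eisenstein and
non-anomalous at `p` (`partner_good_red_not_anom`) with `L(E^{(d_K)},1) ≠ 0`, so Wuthrich 2014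
Prop. 21 (`hW`: `#Ш ∣ #Ш_an` away from additive and small-image primes; Kato's Euler system)
gives `BSDp Wd p` (`bsdp_of_good_red_rankZero_of_shaAn_unit`), and §2 transfers it. Named inputs:
A157 (5.5), Wuthrich Prop. 21, Gross–Zagier (`hGZ`, `hGZQ`), Kolyvagin, GZK, modularity — no parity
hypothesis, no Castella–Grossi–Skinner 2025 / [BSTW] input.
[cite: CastellaGrossiLeeSkinner2022, proof of Thm. 5.3.1, (5.5)–(5.7)] [cite: Wuthrich2014, Prop. 21 (p. 400)]
[cite: GrossZagier1986, Thm. I.7.3] [cite: Miller2011LMS, Def. 1.1] -/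
theorem RowC6.bsdp_rankOne_of_display55_of_twistShaAnUnit (h55 : display55_sha_heegnerIndex)
    (hW : sha_dvd_analyticSha)
    (hmodP : nonempty_modularParametrizationData) (hnf : exists_isNewformOf)
    (hGZQ : GrossZagier1986_thm_I_7_3)
    (hGZ : ∀ (N : ℕ) [NeZero N] (W : WeierstrassCurve ℚ) (K : Type) [Field K] [NumberField K],
      gross_zagier N W K)
    (hKo : ∀ (N : ℕ) [NeZero N] (W : WeierstrassCurve ℚ) (K : Type) [Field K] [NumberField K],
      kolyvagin N W K)
    (hGZK : rank_eq_analyticRank_of_analyticRank_le_one)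
    (W : WeierstrassCurve ℚ) [W.IsElliptic] [W.IsGloballyMinimal] (p : ℕ) [Fact p.Prime]
    (hp : 2 < p) (hgood : Good W p) (hred : Red W p) (hna : ¬ Anom W p) (hr : W.analyticRank = 1)
    (K : Type) [Field K] [NumberField K] (hK : IsImaginaryQuadratic K)
    (hodd : Odd (NumberField.discr K)) (hlt : NumberField.discr K < -4)
    (hHN : SatisfiesHeegnerHypothesis (W.conductorNorm ℤ) K) (hHp : SatisfiesHeegnerHypothesis p K)
    (hLt : (W.quadraticTwist (NumberField.discr K : ℚ)).entireLFunction 1 ≠ 0)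
    (Wd : WeierstrassCurve ℚ) [Wd.IsElliptic] [Wd.IsGloballyMinimal]
    (hWd : ∃ C : VariableChange ℚ, C • Wd = W.quadraticTwist (NumberField.discr K : ℚ))
    (hunit : ∃ q : ℚ, shaAn Wd = (q : ℂ) ∧ padicValRat p q = 0) : BSDp W p := by
  have hmod : hasEntireLFunction_rat := hasEntireLFunction_rat_of_exists_isNewformOf hnf
  obtain ⟨hgood_d, hred_d, -⟩ := partner_good_red_not_anom hp hgood hred hna K hK hodd hHp Wd hWd
  have hrd : Wd.analyticRank = 0 := RowC6.analyticRank_twist_eq_zero hmod W K hLt Wd hWd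
  have hBd : BSDp Wd p :=
    bsdp_of_good_red_rankZero_of_shaAn_unit hW hmod hGZK Wd p hp hgood_d hred_d hrd hunit
  exact (RowC6.bsdp_rankOne_iff_bsdp_twist_of_display55 h55 hmodP hnf hGZQ hGZ hKo hGZK W p hp hgood
    hred hna hr K hK hodd hlt hHN hHp hLt Wd hWd).2 hBd

/-- **Row C6 ∩ {r = 1} when the TWIST has Greenberg–Vatsal parity: no certificate** (the locus of
CGLS22 Thm. F read on `E^K`, from (5.5) and Greenberg–Vatsal 2000 Thm. 1.3 + Greenberg Thm. 4.1 on the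
rank-zero twist). For `W`, `p`, `K`, `Wd` as in `RowC6.bsdp_rankOne_of_display55_of_twistShaAnUnit` and
`GVPar Wd p`: `BSDp W p` — the twist is good ordinary at `p` (`partner_good_red_not_anom`,
`goodOrd_of_red_of_good`), so `bsdp_of_gvPar_of_analyticRank_eq_zero` gives `BSDp Wd p` and §2
transfers it. Beilinson–Flach-free; compare `RowC6.bsdp_rankOne_of_display55_of_gvThm13`, which reads
the parity on a rational line of `E` itself. [cite: CastellaGrossiLeeSkinner2022, Theorem F = Thm. 5.3.1 and its proof]
[cite: GreenbergVatsal2000, Thm. (1.3)] [cite: GreenbergLNM1716, Thm. 4.1 (p. 102)] -/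
theorem RowC6.bsdp_rankOne_of_display55_of_twistGVPar (h55 : display55_sha_heegnerIndex)
    (hGV : GreenbergVatsal2000.thm13_charIdeal_eq_of_gvPar) (hGr : greenberg_charValue_rankZero)
    (hmodP : nonempty_modularParametrizationData) (hnf : exists_isNewformOf)
    (hGZQ : GrossZagier1986_thm_I_7_3)
    (hGZ : ∀ (N : ℕ) [NeZero N] (W : WeierstrassCurve ℚ) (K : Type) [Field K] [NumberField K],
      gross_zagier N W K)
    (hKo : ∀ (N : ℕ) [NeZero N] (W : WeierstrassCurve ℚ) (K : Type) [Field K] [NumberField K],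
      kolyvagin N W K)
    (hGZK : rank_eq_analyticRank_of_analyticRank_le_one)
    (W : WeierstrassCurve ℚ) [W.IsElliptic] [W.IsGloballyMinimal] (p : ℕ) [Fact p.Prime]
    (hp : 2 < p) (hgood : Good W p) (hred : Red W p) (hna : ¬ Anom W p) (hr : W.analyticRank = 1)
    (K : Type) [Field K] [NumberField K] (hK : IsImaginaryQuadratic K)
    (hodd : Odd (NumberField.discr K)) (hlt : NumberField.discr K < -4)
    (hHN : SatisfiesHeegnerHypothesis (W.conductorNorm ℤ) K) (hHp : SatisfiesHeegnerHypothesis p K)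
    (hLt : (W.quadraticTwist (NumberField.discr K : ℚ)).entireLFunction 1 ≠ 0)
    (Wd : WeierstrassCurve ℚ) [Wd.IsElliptic] [Wd.IsGloballyMinimal]
    (hWd : ∃ C : VariableChange ℚ, C • Wd = W.quadraticTwist (NumberField.discr K : ℚ))
    (hpar : GVPar Wd p) : BSDp W p := by
  have hmod : hasEntireLFunction_rat := hasEntireLFunction_rat_of_exists_isNewformOf hnf
  obtain ⟨hgood_d, hred_d, -⟩ := partner_good_red_not_anom hp hgood hred hna K hK hodd hHp Wd hWd
  have hrd : Wd.analyticRank = 0 := RowC6.analyticRank_twist_eq_zero hmod W K hLt Wd hWd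
  have hBd : BSDp Wd p :=
    bsdp_of_gvPar_of_analyticRank_eq_zero hGV hGr hmod hmodP hGZK Wd p (by omega)
      (goodOrd_of_red_of_good Wd p hp hgood_d hred_d) hpar hrd
  exact (RowC6.bsdp_rankOne_iff_bsdp_twist_of_display55 h55 hmodP hnf hGZQ hGZ hKo hGZK W p hp hgood
    hred hna hr K hK hodd hlt hHN hHp hLt Wd hWd).2 hBd

end Summit.BirchSwinnertonDyer.Rank1Residual

end
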